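import Literature.Probability.Percolation.Percolation
import Literature.Probability.Percolation.Crossings
import Literature.Probability.Percolation.RSW
import Literature.Probability.Percolation.LatticeSymmetry
import Literature.Probability.Percolation.PlanarDuality
import HarnessLib

/-!
# Stub `stub_passageLeArm` of line `ip-passage-stirling`
(crux `CardyBoundaryCoulombGas.HalfPlaneOneArmThird`, stmt-CriticalPhenomena-5662)

The cheap half of the matched-scale dictionary between the Ikhlef–Ponsaing wall passage
probability and the diagonal half-plane one-arm probability of bond percolation on `ℤ²` at
`p = 1/2`:
`P_b(2n+1) ≤ π◇(n)` for every `n ≥ 1`.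

Write `s v = v₀ + v₁` and `d v = v₀ - v₁` for the DIAGONAL coordinates of a site `v` of `ℤ²`;
every lattice edge changes `s` by `±1` AND `d` by `±1` (`diag_of_adj`).
* `P_b(2n+1) = P[(2n, 0) ↔ {s = 0} inside the strip {0 ≤ s ≤ 2n+1}]` (left-hand side);
* `π◇(n) = P[0 ↔ {s = -n} ∪ {d = n} ∪ {d = -n} inside the diamond half-box
  {s ≤ 1, -n ≤ s, -n ≤ d ≤ n}]` (right-hand side).

Proof.
1. TRANSLATION by `-(2n, 0)` (`real_openCrossing_shift`, translation invariance of `P_{1/2}`):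
   the left-hand side is the open crossing event `C(strip; {(2n,0)}, {s = 0})`, the image under
   `· + (2n, 0)` of `C({-2n ≤ s ≤ 1}; {0}, {s = -2n})`, so
   `P_b(2n+1) = P[0 ↔ {s = -2n} inside {-2n ≤ s ≤ 1}]`.
2. FIRST EXIT (almost sure inclusion; `P_p` is carried by lattice configurations,
   `ae_subset_edgeSet`): an open walk from `0` to a site of level `s = -2n < -n` inside
   `{s ≤ 1}` leaves the open region `T = {-n < s, |d| < n}` (which contains `0` as `n ≥ 1`);
   stop it at the first vertex `g ∉ T`.  The last edge changes `s` and `d` by exactly one, so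
   `-n ≤ s g`, `|d g| ≤ n`, `s g ≤ 1` and `s g = -n ∨ d g = n ∨ d g = -n`; the initial segment
   lies in `T ∩ {s ≤ 1} ⊆` the diamond half-box.  Hence the translated event is contained in
   the one-arm event (`first_exit`, a direct induction along the walk).

Only tree lemmas are used (`real_openCrossing_shift`, `ae_subset_edgeSet`, `zdGraph_two_adj_iff`,
`openCrossing`, `openConnIn`); no named fact enters.
-/

namespace Summit.CriticalPhenomena.CardyFormulaZ2.Cruxes.HalfPlaneOneArmThird.IpPassageStirling

open MeasureTheory Literature.Probability.Percolation Literature.Probability.LatticeModels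

/-! ## Lattice edges in diagonal coordinates -/

/-- A lattice edge of `ℤ²` changes `s = x₀ + x₁` by `±1` and `d = x₀ - x₁` by `±1`. -/
private theorem diag_of_adj {x y : Site 2} (h : (zdGraph 2).Adj x y) :
    (y 0 + y 1 = x 0 + x 1 + 1 ∨ y 0 + y 1 + 1 = x 0 + x 1) ∧
      (y 0 - y 1 = x 0 - x 1 + 1 ∨ y 0 - y 1 + 1 = x 0 - x 1) := by
  rw [zdGraph_two_adj_iff] at h
  omega

/-- Open edges of a lattice configuration are lattice edges. -/
private theorem adj_of_openGraph_adj {ω : BondConfig (Site 2)} (hω : ω ⊆ (zdGraph 2).edgeSet)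
    {x y : Site 2} (h : (openGraph ω).Adj x y) : (zdGraph 2).Adj x y :=
  (SimpleGraph.mem_edgeSet (zdGraph 2)).1 (hω ((openGraph_adj ω x y).1 h).1)

/-! ## Walks -/

/-- `{x ↔ y in S}` yields an open walk from `x` to `y` with all vertices in `S`. -/
-- adapted from Literature.Probability.LatticeModels.IsoradialPercolationProofs
-- (`exists_reachable_induce_iff_exists_walk`)
private theorem exists_walk_of_openConnIn {ω : BondConfig (Site 2)} {S : Set (Site 2)}
    {x y : Site 2} (h : ω ∈ openConnIn S x y) :
    ∃ W : (openGraph ω).Walk x y, ∀ v ∈ W.support, v ∈ S := by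
  obtain ⟨hx, hy, ⟨q⟩⟩ := h
  refine ⟨(q.map (SimpleGraph.Embedding.induce S).toHom).copy rfl rfl, fun v hv => ?_⟩
  rw [SimpleGraph.Walk.support_copy, SimpleGraph.Walk.support_map] at hv
  obtain ⟨u, -, rfl⟩ := List.mem_map.1 hv
  exact u.2

/-- **First exit from the diamond.** On a lattice configuration, an open walk inside `{s ≤ 1}`
from a site `x` of the open region `T = {-n < s, -n < d < n}` to a site outside `T` contains an
initial open path, inside the diamond half-box `{s ≤ 1, -n ≤ s, -n ≤ d ≤ n}`, from `x` to a site
`g` of its outer boundary `{s = -n} ∪ {d = n} ∪ {d = -n}` (the first vertex of the walk outside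
`T`: the last edge moves `s` and `d` by exactly one). -/
private theorem first_exit {n : ℕ} {ω : BondConfig (Site 2)} (hω : ω ⊆ (zdGraph 2).edgeSet)
    {x y : Site 2} (W : (openGraph ω).Walk x y) :
    (∀ v ∈ W.support, v 0 + v 1 ≤ 1) →
      (-(n : ℤ) < x 0 + x 1 ∧ -(n : ℤ) < x 0 - x 1 ∧ x 0 - x 1 < n) →
      ¬ (-(n : ℤ) < y 0 + y 1 ∧ -(n : ℤ) < y 0 - y 1 ∧ y 0 - y 1 < n) →
      ∃ g : Site 2, (g 0 + g 1 = -(n : ℤ) ∨ g 0 - g 1 = (n : ℤ) ∨ g 0 - g 1 = -(n : ℤ)) ∧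
        ω ∈ openConnIn {v : Site 2 | v 0 + v 1 ≤ 1 ∧ -(n : ℤ) ≤ v 0 + v 1 ∧
          -(n : ℤ) ≤ v 0 - v 1 ∧ v 0 - v 1 ≤ n} x g := by
  induction W with
  | nil => intro _ hx hy; exact absurd hx hy
  | @cons u v w hadj W' ih =>
    intro hW hu hy
    have hu1 : u 0 + u 1 ≤ 1 := hW u (SimpleGraph.Walk.start_mem_support _)
    have hW' : ∀ t ∈ W'.support, t 0 + t 1 ≤ 1 := fun t ht =>
      hW t (by rw [SimpleGraph.Walk.support_cons]; exact List.mem_cons_of_mem u ht)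
    have hv1 : v 0 + v 1 ≤ 1 := hW' v (SimpleGraph.Walk.start_mem_support _)
    have huD : u ∈ {v : Site 2 | v 0 + v 1 ≤ 1 ∧ -(n : ℤ) ≤ v 0 + v 1 ∧
        -(n : ℤ) ≤ v 0 - v 1 ∧ v 0 - v 1 ≤ n} := by
      simp only [Set.mem_setOf_eq]; omega
    by_cases hvT : -(n : ℤ) < v 0 + v 1 ∧ -(n : ℤ) < v 0 - v 1 ∧ v 0 - v 1 < n
    · obtain ⟨g, hg, hvD, hgD, hr⟩ := ih hW' hvT hy
      have hadj' : ((openGraph ω).induce {v : Site 2 | v 0 + v 1 ≤ 1 ∧ -(n : ℤ) ≤ v 0 + v 1 ∧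
          -(n : ℤ) ≤ v 0 - v 1 ∧ v 0 - v 1 ≤ n}).Adj ⟨u, huD⟩ ⟨v, hvD⟩ := hadj
      exact ⟨g, hg, huD, hgD, hadj'.reachable.trans hr⟩
    · have hd := diag_of_adj (adj_of_openGraph_adj hω hadj)
      have hvD : v ∈ {v : Site 2 | v 0 + v 1 ≤ 1 ∧ -(n : ℤ) ≤ v 0 + v 1 ∧
          -(n : ℤ) ≤ v 0 - v 1 ∧ v 0 - v 1 ≤ n} := by
        simp only [Set.mem_setOf_eq]; omega
      have hadj' : ((openGraph ω).induce {v : Site 2 | v 0 + v 1 ≤ 1 ∧ -(n : ℤ) ≤ v 0 + v 1 ∧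
          -(n : ℤ) ≤ v 0 - v 1 ∧ v 0 - v 1 ≤ n}).Adj ⟨u, huD⟩ ⟨v, hvD⟩ := hadj
      exact ⟨v, by omega, huD, hvD, hadj'.reachable⟩

/-! ## Translation -/

/-- Translating by `a` shifts the level: the image of a level set `{P (s - (a₀ + a₁))}` under
`· + a` is `{P s}`. -/
private theorem image_shift_levelSet (a : Site 2) (P : ℤ → Prop) :
    (· + a) '' {x : Site 2 | P (x 0 + x 1 + (a 0 + a 1))} = {x | P (x 0 + x 1)} := by
  ext x
  constructor
  · rintro ⟨y, hy, rfl⟩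
    simp only [Set.mem_setOf_eq, Pi.add_apply] at hy ⊢
    rwa [show y 0 + a 0 + (y 1 + a 1) = y 0 + y 1 + (a 0 + a 1) by ring]
  · intro hx
    refine ⟨x - a, ?_, sub_add_cancel x a⟩
    simp only [Set.mem_setOf_eq, Pi.sub_apply] at hx ⊢
    rwa [show x 0 - a 0 + (x 1 - a 1) + (a 0 + a 1) = x 0 + x 1 by ring]

/-- The site `(2n, 0)` has level `2n`. -/
private theorem level_corner (n : ℕ) :
    (![2 * (n : ℤ), 0] : Site 2) 0 + (![2 * (n : ℤ), 0] : Site 2) 1 = 2 * (n : ℤ) := by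
  simp

/-- **Translation step**: `P_b(2n+1) = P[0 ↔ {s = -2n} inside {-2n ≤ s ≤ 1}]` (as an open
crossing event), by translation invariance of `P_{1/2}` under `· + (2n, 0)`. -/
private theorem real_passage_eq_shift (n : ℕ) :
    (bondPercolation (zdGraph 2) half).real
        {ω | ∃ y : Site 2, y 0 + y 1 = 0 ∧
          ω ∈ openConnIn {v : Site 2 | 0 ≤ v 0 + v 1 ∧ v 0 + v 1 ≤ 2 * (n : ℤ) + 1}
            ![2 * (n : ℤ), 0] y} =
      (bondPercolation (zdGraph 2) half).real
        (openCrossing {v : Site 2 | 0 ≤ v 0 + v 1 + 2 * (n : ℤ) ∧ v 0 + v 1 + 2 * (n : ℤ) ≤ 2 * (n : ℤ) + 1}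
          {(0 : Site 2)} {w : Site 2 | w 0 + w 1 + 2 * (n : ℤ) = 0}) := by
  set a : Site 2 := ![2 * (n : ℤ), 0] with ha
  have hlev : a 0 + a 1 = 2 * (n : ℤ) := level_corner n
  have key := real_openCrossing_shift half a
    {v : Site 2 | 0 ≤ v 0 + v 1 + (a 0 + a 1) ∧ v 0 + v 1 + (a 0 + a 1) ≤ 2 * (n : ℤ) + 1}
    {(0 : Site 2)} {w : Site 2 | w 0 + w 1 + (a 0 + a 1) = 0}
  rw [image_shift_levelSet a fun t => 0 ≤ t ∧ t ≤ 2 * (n : ℤ) + 1,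
    image_shift_levelSet a fun t => t = 0, Set.image_singleton, zero_add] at key
  rw [hlev] at key
  rw [← key]
  congr 1
  ext ω
  simp only [Set.mem_setOf_eq, mem_openCrossing_iff, Set.mem_singleton_iff, exists_eq_left]

/-! ## The stub -/

/-- **S3 `stub_passageLeArm`** (`= PassageLeArm` verbatim): for every `n ≥ 1`,
`P_b(2n+1) ≤ π◇(n)`, i.e.
`P[(2n,0) ↔ {s = 0} inside {0 ≤ s ≤ 2n+1}] ≤ P[0 ↔ {s = -n} ∪ {d = ±n} inside the diamond
half-box {s ≤ 1, -n ≤ s, |d| ≤ n}]` for bond percolation on `ℤ²` at `p = 1/2`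
(translation by `-(2n, 0)` and first exit from the diamond, an almost sure inclusion of events). -/
theorem stub_passageLeArm :
    ∀ n : ℕ, 1 ≤ n →
      (bondPercolation (zdGraph 2) half).real
          {ω | ∃ y : Site 2, y 0 + y 1 = 0 ∧
            ω ∈ openConnIn {v : Site 2 | 0 ≤ v 0 + v 1 ∧ v 0 + v 1 ≤ 2 * (n : ℤ) + 1}
              ![2 * (n : ℤ), 0] y} ≤
      (bondPercolation (zdGraph 2) half).real
          {ω | ∃ y : Site 2, (y 0 + y 1 = -(n : ℤ) ∨ y 0 - y 1 = (n : ℤ) ∨ y 0 - y 1 = -(n : ℤ)) ∧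
            ω ∈ openConnIn {v : Site 2 | v 0 + v 1 ≤ 1 ∧ -(n : ℤ) ≤ v 0 + v 1 ∧
              -(n : ℤ) ≤ v 0 - v 1 ∧ v 0 - v 1 ≤ n} 0 y} := by
  intro n hn
  rw [real_passage_eq_shift n]
  refine ENNReal.toReal_mono (measure_ne_top _ _) (measure_mono_ae ?_)
  filter_upwards [ae_subset_edgeSet (zdGraph 2) half] with ω hω hmem
  obtain ⟨x, hx, y, hy, hconn⟩ := hmem
  rw [Set.mem_singleton_iff] at hx
  subst hx
  simp only [Set.mem_setOf_eq] at hy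
  obtain ⟨W, hW⟩ := exists_walk_of_openConnIn hconn
  exact first_exit hω W (fun v hv => by have := (hW v hv).2; omega)
    (by simp only [Pi.zero_apply]; omega) (by omega)

end Summit.CriticalPhenomena.CardyFormulaZ2.Cruxes.HalfPlaneOneArmThird.IpPassageStirling
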